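import Summits.QuantumFields.YangMills.Theorems.BalabanUVNodesRateCarriersOfRecord13Co
import Summits.QuantumFields.YangMills.Theorems.BalabanUVNodesN18AtRateRecord13

/-!
# ⁵ (`Co`) EDITION of `BalabanUVNodesN18AtRateRecord13` (p496197) — seat pub-ymgap-dag-n18-d (N18 = NE5, strategy s2), RE-KEYED on the proviso binder `Stage13Params.Provisos₁₃Core` ∕ the datum `Node00.datumOfRecord₁₃Co` (def-T's record module, p515035), RR-2's datum key `Node00.IsDatumOfRecord₁₃CCo` (p515777) and dag-n22-e's
# (T-RATE) layer-B homes (`RateReading₁₃Co`, `RRec₁₃Co`, `RRec₁₃CoOn`, `readingOfRecord₁₃Co`, `s_N18_rRec₁₃Co(On)_iff`, `forall_datumKey₁₃Co_of_forall_admissible`, `readingOfRecord₁₃Co_u3`)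
#
# WHY (route `route-QuantumFields-BalabanUVNodes`; dag-lead KEY MAP of record): director-ym №151∕№152 RE-BASED the Stage-13 record at print's background (the minimiser over [6]'s class (1.7) ∧ (1.9), `UbgOfRecord₁₃Co`); def-T re-generated the record
# family over it (deprecate-and-add), the (T-RATE) layer B re-keyed its homes on it (KEY-RULE-21), and a theorem binding an OLD datum∕key cannot be fed from the new one —
# so every storey binding a Stage-13 proviso∕datum key is re-keyed ONCE more.  THIS FILE is the twin of this seat's own ‴ module under the token map `Provisos₁₃ ↦ Provisos₁₃Core` ·
# `datumOfRecord₁₃ ↦ datumOfRecord₁₃Co` · `IsDatumOfRecord₁₃C ↦ IsDatumOfRecord₁₃CCo` · `RateReading₁₃ ↦ RateReading₁₃Co` · `RRec₁₃ ↦ RRec₁₃Co` · `RRec₁₃On ↦ RRec₁₃CoOn` ·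
# `readingOfRecord₁₃ ↦ readingOfRecord₁₃Co` · `s_N18_rRec₁₃(On)_iff ↦ s_N18_rRec₁₃Co(On)_iff` · `forall_datumKey₁₃_of_forall_admissible ↦ forall_datumKey₁₃Co_of_forall_admissible`, and in
# THIS seat's decl names `rRec₁₃ ↦ rRec₁₃Co`, `readingOfRecord₁₃ ↦ readingOfRecord₁₃Co`; statements = the ‴ statements under the map, proofs = the ‴ proofs VERBATIM.
# EVERYTHING θ-LEVEL IS UNCHANGED AND NOT RE-DECLARED (`Stage13Params`, `u3OfRecord₁₃`, the per-tuple faces and junctions of the original carry no proviso ∕ key and are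
# IMPORTED BY NAME — this module imports its ‴ original) — here: `n18At_u3OfRecord₁₃_readingData_iff`, `n18At_u3OfRecord₁₃_readingData_iff_pairing`, `n18At_u3OfRecord₁₃_readingAdm_iff`, `n18At_u3OfRecord₁₃_readingAdm_of_envelope_bound238`.
# ITEM IDS quoted in the ‴ header below (K3‴ `SpineGivenEndpointR13`, stmt-QuantumFields-19912; K0‴) are ASIDES; this file is filed as a HELPER on the K3 item of the
# dag-lead KEY MAP of record — COUNT-NEUTRAL, no stub closed, N18 NOT discharged, no inhabitant of any key claimed (K0 OPEN).
#
# ‴ HEADER OF RECORD FOLLOWS (token-mapped; its decl list is this file's, the θ-only names above excepted):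
#
# BalabanUVNodes ∕ node N18 = NE5 — N18's STAGE-13 HOME: the statement of record `S_N18 (RRec₁₃Co 𝔯)` for ANY Stage-13 rate reading pinned to W1 reading data,
# in closed form, at the admissible reading, and the junction row at the record of record
# (Track A, DAG node N18 = `T4OutputRate.NE5` :211; cluster K4 «SpineRates», item K3‴ `SpineGivenEndpointR13`; module 18 of seat pub-ymgap-dag-n18-d, strategy s2)

HONEST FRAMING.  Count-neutral kernel bookkeeping (`--supports … --as helper`), composition BY NAME of landed theorems; NE5 is NOT PRINTED and NOT proved;
N18 is NOT discharged; no inhabitant of `IsDatumOfRecord₁₃CCo` is claimed (K0‴ `Record13Inhabited`, OPEN); no `₁₂ ↔ ₁₃` bridge is used or claimed.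

WHY.  The route's cruxes are re-keyed at NODE 00's Stage-13 record (rev 16 ∕ 17: K3‴ `SpineGivenEndpointR13` over `Node00.Stage13Params F 2`); the (T-RATE) pen's
layer B at ₁₃ (`…RateCarriersOfRecord13`, dag-n22-e g5) typed the home `RRec₁₃Co 𝔯` keyed by `IsDatumOfRecord₁₃CCo`, with node U3's bundle
`u3OfRecord₁₃ θ u k = u3OfRecord₁₂ θ.toStage12Params u k` (`rfl`) and the one-application face `s_N18_rRec₁₃Co_iff`.  This lineage's modules 7–17 are keyed ₁₂.
THIS FILE is N18's side at the Stage-13 home, GENERALISED (as dag-n22-e's N22 module 9″c) to ANY reading `𝔯 : RateReading₁₃Co N` whose node-U3 objects ARE a W1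
reading-data family's, `hpin : (𝔯.lit F θ hP g₀ os).u3 = (W F θ).u3Objects θ.γ` (`rfl` for every W1-built reading): per level the statement is W1's η-rate
inequality by `Iff.rfl` (§1); at the home the keys are Stage-13 datum keys and the construction data `(g₀, os)` drop out (§2); at the ADMISSIBLE reading family
indexed by Stage-13 tuples the closed form quantifies the run-B fields READ INSIDE THE TABLES and the junction row of module 12 §3 — END data + the towers' H-layer
data on the tables ⇒ `S_N18` — is re-run AT THE RECORD OF RECORD from module 12 §1's θ-free per-level theorem (§3): its hypothesis is asked at the admissible
Stage-13 tuples with `Provisos₁₃Core`, its conclusion is `S_N18 (RRec₁₃Co 𝔯)`.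

WHAT (all `theorem`, 0 `def`).
* §1 per level (generic `RD : ReadingData F (MatA N) θ.τ9.M`, `θ : Stage13Params F N`): `n18At_u3OfRecord₁₃_readingData_iff` (`Iff.rfl`),
  `n18At_u3OfRecord₁₃_readingData_iff_pairing` (`Iff.rfl`), `n18At_u3OfRecord₁₃_readingAdm_iff` (at `ReadingData.ofRecordAdm`),
  ★ `n18At_u3OfRecord₁₃_readingAdm_of_envelope_bound238` (the junction at ONE tuple and level: END data + H-layer data on the tables ⇒ `N18At`).
* §2 the home for a pinned reading: ★ `s_N18_rRec₁₃Co_iff_of_pin`, `n18At_of_s_N18_rRec₁₃Co_pin`, `s_N18_rRec₁₃Co_of_forall_admissible_pin`.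
* §3 the admissible reading family at Stage 13: ★ `s_N18_rRec₁₃Co_readingAdm_iff_of_pin`, `s_N18_rRec₁₃Co_readingAdm_of_forall_pin`,
  ★ `s_N18_rRec₁₃Co_readingAdm_of_envelope_bound238_pin` (the row at the record of record).

One finite four-torus programme at fixed `ε`; NOT the continuum limit, NOT OS, NOT a mass gap, NOT Clay.  0 `def`, 0 `sorry`.  Sources (TYPES only): T. Bałaban,
CMP **109** (1987) [Balaban1987RG1] (0.24)–(0.25) p. 257, Thm 1 p. 259, (1.11)–(1.16) p. 262, (1.18) p. 263; CMP **116** (1988) [Balaban1988RG2Cluster] (2.13) p. 14,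
(2.16)–(2.18) p. 16, Lemma 3 (2.38) p. 20; CMP **122** (1989) [Balaban1989LargeFieldII] (the record's stage).
-/

noncomputable section

open Set Metric
open scoped Matrix.Norms.L2Operator

namespace YMDAG.N18.W1Reading

open Literature.MathematicalPhysics.QuantumFieldTheory.Balaban1983to89
open Literature.MathematicalPhysics.QuantumFieldTheory.Balaban1983to89.T4Continuum
open Literature.MathematicalPhysics.QuantumFieldTheory.Balaban1983to89.T4OutputRate (Carriers Functional NE5 DecayBound Window)
open Literature.MathematicalPhysics.QuantumFieldTheory.Balaban1983to89.T4InputCauchyRateData (StepModel)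
open Literature.MathematicalPhysics.QuantumFieldTheory.Balaban1983to89.B13Resummation (locE)
open Literature.MathematicalPhysics.QuantumFieldTheory.Balaban1983to89.TreeLengthTorus (TDom tsys torusTreeLen)
open Literature.MathematicalPhysics.QuantumFieldTheory.Balaban1983to89.TreeLengthTorusGeometry (TTouch)
open Literature.MathematicalPhysics.QuantumFieldTheory.Balaban1983to89.B12TreeDecay (K₀)
open Literature.MathematicalPhysics.QuantumFieldTheory.Balaban1983to89.Node00 (Stage12Params Stage13Params IsDatumOfRecord₁₃CCo datumOfRecord₁₃Co U3Letters₁₁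
  U3Objects₁₁ NE2Objects₁₁ NE3Letters₁₁ prependCoupling MatA ιSU avOfRecord)
open Literature.MathematicalPhysics.QuantumFieldTheory.Balaban1983to89.Node00.Sect2 (domCount domSys CPair ofBackgroundC)
open Literature.MathematicalPhysics.QuantumFieldTheory.Balaban1983to89.Node00.W1 (ReadingData LevelPairing LetterInputs ClusterTower pairOfRecord
  dj_pairOfRecord functionalC functional box SpRestr)
open Summit.QuantumFields.BalabanUV.T4Continuum.B13Carriers (transportRaw)
open Summit.QuantumFields.BalabanUV.T4Continuum.Spine.NE5
open Summit.QuantumFields.YangMills.BalabanUVNodes.N18AtByName (n18At_mono)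
open YMDAG.N18.HLayer
open YMDAG.UVSplit

variable {N : ℕ} [NeZero N]

/-! ## §2 The Stage-13 home for a reading pinned to W1 reading data -/

section Pinned

variable (𝔯 : RateReading₁₃Co N) (W : (F : T4Family) → (θ : Stage13Params F N) → ReadingData F (MatA N) θ.τ9.M)
  (hpin : ∀ (F : T4Family) (θ : Stage13Params F N) (hP : θ.Provisos₁₃Core F N) (g₀ : ℕ → ℝ) (os : List (ULoop F)),
    (𝔯.lit F θ hP g₀ os).u3 = (W F θ).u3Objects θ.γ)

include hpin in
/-- ★ **N18's STATEMENT OF RECORD AT THE STAGE-13 HOME, CLOSED FORM, FOR ANY READING PINNED TO W1 READING DATA** [bookkeeping; layer B's `s_N18_rRec₁₃Co_iff` + `hpin` + §1]: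
`S_N18 (RRec₁₃Co 𝔯)` ⇔ for every family `F`, every datum of record `D` with Stage-13 key `h` (canonical parameter `θ := h.params`), every run length `k`, member
`b ∈ ]0, θ.γ]`, history `g ∈ ]0, θ.γ]^ℕ`, run-B background `U` and run-A domain `(j, X)`:
`|Re E_A^{(j)}(X; g; embA (transport U)) − Re E_B(pair (j, X); b∷g; embB U)| ≤ C₅ · θ₅ ^ j · e^{−κ·d_j(X)}` for the objects of `W F θ`.  The construction data `(g₀, os)`
drop out (the pinned objects read only `(F, θ)`).  NOT PRINTED; NOT proved. [cite: Balaban1987RG1, Thm 1 p.259 and (1.18) p.263; Balaban1988RG2Cluster, (2.13) p.14] -/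
theorem s_N18_rRec₁₃Co_iff_of_pin :
    S_N18 (RRec₁₃Co 𝔯) ↔
      ∀ (F : T4Family) (D : Datum F N) (h : IsDatumOfRecord₁₃CCo F N D) (k : ℕ) (b : ℝ), 0 < b → b ≤ h.params.γ →
        ∀ g ∈ Window h.params.γ, ∀ (U : ((W F h.params).pairing k).BgB) (X : Node00.W1.Dom (F.P k) h.params.τ9.M),
          |(functionalC ((W F h.params).S k) g (((W F h.params).pairing k).embA (((W F h.params).pairing k).transport U)) X).re -
              (functionalC ((W F h.params).S (k + 1)) (prependCoupling b g) (((W F h.params).pairing k).embB U)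
                (((W F h.params).pairing k).pair X)).re| ≤
            (W F h.params).li.C₅ * (W F h.params).li.θ₅ ^ X.1 *
              Real.exp (-((W F h.params).li.κ * (domSys (F.P k) h.params.τ9.M X.1).dj X.2)) := by
  rw [s_N18_rRec₁₃Co_iff]
  constructor
  · intro H F D h k
    have h₁ := H F D h (fun _ => 0) [] k
    rw [hpin] at h₁
    exact h₁
  · intro H F D h g₀ os k
    rw [hpin]
    exact H F D h k

include hpin in
/-- **WHAT IT HANDS BACK AT A DATUM KEY AND A LEVEL** [bookkeeping]: `N18At` at the Stage-13 bundle of the pinned reading data. [cite: Balaban1987RG1, Thm 1 p.259 and (1.18) p.263] -/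
theorem n18At_of_s_N18_rRec₁₃Co_pin (hS : S_N18 (RRec₁₃Co 𝔯)) {F : T4Family} {D : Datum F N} (h : IsDatumOfRecord₁₃CCo F N D) (k : ℕ) :
    N18At (u3OfRecord₁₃ h.params ((W F h.params).u3Objects h.params.γ) k) := by
  have h₁ := (s_N18_rRec₁₃Co_iff 𝔯).1 hS F D h (fun _ => 0) [] k
  rwa [hpin] at h₁

include hpin in
/-- **THE θ-FORM SUFFICIENT CONDITION AT THE STAGE-13 HOME** [bookkeeping; layer B's `forall_datumKey₁₃Co_of_forall_admissible`]: `N18At` at the Stage-13 bundle of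
the pinned reading data at EVERY admissible Stage-13 tuple with provisos and every run length gives `S_N18 (RRec₁₃Co 𝔯)`. [cite: Balaban1987RG1, Thm 1 p.259 and (1.18) p.263] -/
theorem s_N18_rRec₁₃Co_of_forall_admissible_pin
    (h : ∀ (F : T4Family) (θ : Stage13Params F N), θ.Provisos₁₃Core F N → θ.Admissible F N → ∀ k : ℕ, N18At (u3OfRecord₁₃ θ ((W F θ).u3Objects θ.γ) k)) :
    S_N18 (RRec₁₃Co 𝔯) := by
  rw [s_N18_rRec₁₃Co_iff]
  intro F D hk g₀ os k
  rw [hpin]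
  exact forall_datumKey₁₃Co_of_forall_admissible (P := fun F _ θ _ _ _ k => N18At (u3OfRecord₁₃ θ ((W F θ).u3Objects θ.γ) k))
    (fun F θ hθ hA _ _ k => h F θ hθ hA k) F D hk g₀ os k

end Pinned

/-! ## §3 At the admissible reading family indexed by the Stage-13 tuples -/

section Adm

variable (𝔯 : RateReading₁₃Co N)
  (S : (F : T4Family) → (θ : Stage13Params F N) → (k : ℕ) → ClusterTower (F.P k) (MatA N) θ.τ9.M)
  (sp : (F : T4Family) → (θ : Stage13Params F N) → (k j : ℕ) → (domSys (F.P k) θ.τ9.M j).Dom → Set (CPair (F.P k) (MatA N)))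
  (gauge : (F : T4Family) → (θ : Stage13Params F N) → (k : ℕ) → GaugeField (F.P k) 0 (Node00.SU N) → GaugeField (F.P k) 0 (Node00.SU N) → ℝ)
  (hg : ∀ (F : T4Family) (θ : Stage13Params F N) (k : ℕ) (U U' : GaugeField (F.P k) 0 (Node00.SU N)), 0 ≤ gauge F θ k U U')
  (T₀ : (F : T4Family) → (θ : Stage13Params F N) → (k : ℕ) → GaugeField (F.P (k + 1)) 0 (Node00.SU N) → GaugeField (F.P k) 0 (Node00.SU N))
  (hT : ∀ (F : T4Family) (θ : Stage13Params F N) (k : ℕ) (U : GaugeField (F.P (k + 1)) 0 (Node00.SU N)),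
    (∀ (j : ℕ) (Y : (domSys (F.P (k + 1)) θ.τ9.M j).Dom), ofBackgroundC (ιSU N) U ∈ sp F θ (k + 1) j Y) →
      ∀ (j : ℕ) (X : (domSys (F.P k) θ.τ9.M j).Dom), ofBackgroundC (ιSU N) (T₀ F θ k U) ∈ sp F θ k j X)
  (li : (F : T4Family) → Stage13Params F N → LetterInputs)
  (hpin : ∀ (F : T4Family) (θ : Stage13Params F N) (hP : θ.Provisos₁₃Core F N) (g₀ : ℕ → ℝ) (os : List (ULoop F)),
    (𝔯.lit F θ hP g₀ os).u3 =
      (ReadingData.ofRecordAdm F θ.τ9.M N (S F θ) (sp F θ) (gauge F θ) (hg F θ) (T₀ F θ) (hT F θ) (li F θ)).u3Objects θ.γ)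

include hpin in
/-- ★ **N18's STATEMENT OF RECORD AT THE STAGE-13 HOME, ADMISSIBLE READING, CLOSED FORM** [bookkeeping; §2 at `W F θ := ReadingData.ofRecordAdm …`, by `rfl`; the ₁₃ twin of
module 12 `s_N18_readingAdm₁₂_iff`]: for any reading pinned to the admissible reading family (towers `S F θ`, tables `sp F θ`, transports `T₀ F θ` with clause `hT`, letters
`li F θ`, all indexed by the Stage-13 tuples), `S_N18 (RRec₁₃Co 𝔯)` ⇔ for every family `F`, Stage-13 datum key `h` (`θ := h.params`), run length `k`, member `b ∈ ]0, θ.γ]`,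
history `g ∈ ]0, θ.γ]^ℕ`, every ADMISSIBLE run-B gauge field `U` of the `(k+1)`-th torus (read inside `sp F θ (k+1)`) and every run-A domain `(j, X)`:
`|Re E^{(j)}_{S_k}(X; g; (ι(T₀ U), 0)) − Re E^{(j+1)}_{S_{k+1}}(πX; b∷g; (ιU, 0))| ≤ C₅ · θ₅ ^ j · e^{−κ·d_j(X)}`.  NOT PRINTED; NOT proved.
[cite: Balaban1987RG1, Thm 1 p.259, (1.11)–(1.16) p.262 and (1.18) p.263; Balaban1988RG2Cluster, (2.13) p.14 and (2.16)–(2.18) p.16] -/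
theorem s_N18_rRec₁₃Co_readingAdm_iff_of_pin :
    S_N18 (RRec₁₃Co 𝔯) ↔
      ∀ (F : T4Family) (D : Datum F N) (h : IsDatumOfRecord₁₃CCo F N D) (k : ℕ) (b : ℝ), 0 < b → b ≤ h.params.γ →
        ∀ g ∈ Window h.params.γ,
          ∀ (U : {U : GaugeField (F.P (k + 1)) 0 (Node00.SU N) //
              ∀ (j : ℕ) (Y : (domSys (F.P (k + 1)) h.params.τ9.M j).Dom), ofBackgroundC (ιSU N) U ∈ sp F h.params (k + 1) j Y})
            (X : Node00.W1.Dom (F.P k) h.params.τ9.M),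
          |(functionalC (S F h.params k) g (ofBackgroundC (ιSU N) (T₀ F h.params k U.1)) X).re -
              (functionalC (S F h.params (k + 1)) (prependCoupling b g) (ofBackgroundC (ιSU N) U.1) (pairOfRecord F h.params.τ9.M k X)).re| ≤
            (li F h.params).C₅ * (li F h.params).θ₅ ^ X.1 * Real.exp (-((li F h.params).κ * (domSys (F.P k) h.params.τ9.M X.1).dj X.2)) :=
  s_N18_rRec₁₃Co_iff_of_pin 𝔯 (fun F θ => ReadingData.ofRecordAdm F θ.τ9.M N (S F θ) (sp F θ) (gauge F θ) (hg F θ) (T₀ F θ) (hT F θ) (li F θ)) hpin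

include hpin in
/-- **THE θ-FORM SUFFICIENT CONDITION AT THE ADMISSIBLE READING, STAGE 13** [bookkeeping]: the displayed inequality at EVERY admissible Stage-13 tuple with provisos, run
length, member, history, admissible run-B field and domain gives `S_N18 (RRec₁₃Co 𝔯)`. [cite: Balaban1987RG1, Thm 1 p.259 and (1.18) p.263] -/
theorem s_N18_rRec₁₃Co_readingAdm_of_forall_pin
    (h : ∀ (F : T4Family) (θ : Stage13Params F N), θ.Provisos₁₃Core F N → θ.Admissible F N → ∀ (k : ℕ) (b : ℝ), 0 < b → b ≤ θ.γ →
      ∀ g ∈ Window θ.γ, ∀ (U : GaugeField (F.P (k + 1)) 0 (Node00.SU N)),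
        (∀ (j : ℕ) (Y : (domSys (F.P (k + 1)) θ.τ9.M j).Dom), ofBackgroundC (ιSU N) U ∈ sp F θ (k + 1) j Y) →
        ∀ X : Node00.W1.Dom (F.P k) θ.τ9.M,
          |(functionalC (S F θ k) g (ofBackgroundC (ιSU N) (T₀ F θ k U)) X).re -
              (functionalC (S F θ (k + 1)) (prependCoupling b g) (ofBackgroundC (ιSU N) U) (pairOfRecord F θ.τ9.M k X)).re| ≤
            (li F θ).C₅ * (li F θ).θ₅ ^ X.1 * Real.exp (-((li F θ).κ * (domSys (F.P k) θ.τ9.M X.1).dj X.2))) :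
    S_N18 (RRec₁₃Co 𝔯) :=
  s_N18_rRec₁₃Co_of_forall_admissible_pin 𝔯 _ hpin fun F θ hP hA k b hb hbγ g hgW U X => h F θ hP hA k b hb hbγ g hgW U.1 U.2 X

include hpin in
open Classical in
/-- ★ **THE JUNCTION ROW AT THE RECORD OF RECORD** [bookkeeping; module 12 §3 `s_N18_readingAdm₁₂_of_envelope_bound238` RE-RUN at the Stage-13 tuples: §1's per-tuple
junction `n18At_u3OfRecord₁₃_readingAdm_of_envelope_bound238` at every admissible tuple and level, θ-form transfer by layer B's `forall_datumKey₁₃Co_of_forall_admissible`].  If at EVERY admissible Stage-13 tuple `θ` with `Provisos₁₃Core` and every run length `k` there are (i) the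
END's data over the carriers of the admissible level pairing (per-member step models representing (2.13) with THE NODE-A MAJORANT AS HYPOTHESIS, L01–L03, rows NE2 ∕ NE3's
L07 ∕ L08, the W3 shapes, numerals, L10, sharp clause) and (ii) restriction-closedness, `AnalyticH` + `Bound238` of the towers `S F θ k ∕ (k+1)` ON THE TABLES `sp F θ k ∕
(k+1)` with amplitudes `A_A ∕ A_B` and STRICT [KP86] clauses, the letters `li F θ` dominating — then `S_N18 (RRec₁₃Co 𝔯)` for every reading `𝔯` pinned to the admissible
reading family.  NO embedding ∕ pairing clause; NO `₁₂ ↔ ₁₃` bridge. [cite: Balaban1988RG2Cluster, (2.13) p.14, (2.16)–(2.18) p.16 and Lemma 3 (2.38) p.20;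
Balaban1987RG1, (0.24)–(0.25) p.257, (1.18) p.263 and Thm 1 p.259] -/
theorem s_N18_rRec₁₃Co_readingAdm_of_envelope_bound238_pin
    (h : ∀ (F : T4Family) (θ : Stage13Params F N), θ.Provisos₁₃Core F N → θ.Admissible F N → ∀ k : ℕ,
      ∃ (Op : Type) (_ : NormedAddCommGroup Op) (_ : NormedSpace ℂ Op) (Hist : Type) (_ : NormedAddCommGroup Hist) (_ : NormedSpace ℂ Hist)
        (Mb : ℝ → StepModel (LevelPairing.ofRecordAdm F θ.τ9.M N k (sp F θ) (gauge F θ k) (hg F θ k) (T₀ F θ k) (hT F θ k)).carriers Op Hist)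
        (act : ℝ → (j : ℕ) → Op × Hist → TDom 4 (domCount (F.P k) θ.τ9.M j) → ℂ) (γ' C3 ε₁ Rd κ A_A A_B E₁ δ δ' θr θ' cH ω ρ₀ B : ℝ) (k₀ : ℕ),
        -- (i) the END's data over the carriers of the admissible level pairing
        (∀ b : ℝ, 0 < b → b ≤ γ' → ∀ (X : Node00.W1.Dom (F.P k) θ.τ9.M) (z : Op × Hist),
          (Mb b).Out X.1 z.1 z.2 X =
            locE (TTouch (d := 4) (N := domCount (F.P k) θ.τ9.M X.1)) (fun Z : (tsys 4 (domCount (F.P k) θ.τ9.M X.1)).Dom => Z.1)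
              (act b X.1 z) X.2.1) ∧
        0 ≤ C3 ∧ 0 ≤ ε₁ ∧ 0 ≤ κ ∧ κ + 2 * (64 * Real.log 162) + 2 ≤ Rd ∧
        C3 * ε₁ * Real.exp (5 * κ + 1) * K₀ 64 8 * 9 * 64 ≤ 1 ∧
        (∀ b : ℝ, 0 < b → b ≤ γ' → ∀ j, ∀ g ∈ Window γ',
          ∀ (U : (LevelPairing.ofRecordAdm F θ.τ9.M N k (sp F θ) (gauge F θ k) (hg F θ k) (T₀ F θ k) (hT F θ k)).BgB) (q : Op × Hist),
          q ∈ (Mb b).Base j g U →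
          ∃ V : Set (Op × Hist), IsOpen V ∧ (Mb b).box j q ⊆ V ∧
            (∀ Z : TDom 4 (domCount (F.P k) θ.τ9.M j), DifferentiableOn ℂ (fun z : Op × Hist => act b j z Z) V) ∧
            (∀ z ∈ V, ∀ Z : TDom 4 (domCount (F.P k) θ.τ9.M j), ‖act b j z Z‖ ≤ C3 * ε₁ * Real.exp (-(Rd * torusTreeLen Z.1)))) ∧
        (∀ b : ℝ, 0 < b → b ≤ γ' → L01 (Mb b)
          ((LevelPairing.ofRecordAdm F θ.τ9.M N k (sp F θ) (gauge F θ k) (hg F θ k) (T₀ F θ k) (hT F θ k)).EA (S F θ k)) (Window γ')) ∧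
        (∀ b : ℝ, 0 < b → b ≤ γ' → L02 (Mb b)
          ((LevelPairing.ofRecordAdm F θ.τ9.M N k (sp F θ) (gauge F θ k) (hg F θ k) (T₀ F θ k) (hT F θ k)).EB (S F θ (k + 1)) b)
          (Window γ')) ∧
        (∀ b : ℝ, 0 < b → b ≤ γ' → L03 (Mb b)
          ((LevelPairing.ofRecordAdm F θ.τ9.M N k (sp F θ) (gauge F θ k) (hg F θ k) (T₀ F θ k) (hT F θ k)).EB (S F θ (k + 1)) b)
          (Window γ')) ∧
        (∀ b : ℝ, 0 < b → b ≤ γ' → L07 (Mb b) (Window γ') δ θr) ∧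
        (∀ b : ℝ, 0 < b → b ≤ γ' → L08 (Mb b) (Window γ') κ (Real.exp 1 * 9 * 64 * K₀ 64 8 ^ 2 * A_B) δ' θr) ∧
        (∀ b : ℝ, 0 < b → b ≤ γ' → L09aff (Mb b) (Window γ')) ∧ (∀ b : ℝ, 0 < b → b ≤ γ' → L09blind (Mb b) (Window γ')) ∧
        (∀ b : ℝ, 0 < b → b ≤ γ' → L09hom (Mb b) (Window γ')) ∧ (∀ b : ℝ, 0 < b → b ≤ γ' → L09unit (Mb b) (Window γ') κ E₁ cH ω) ∧
        0 < E₁ ∧ 0 ≤ δ + δ' ∧ 0 ≤ θr ∧ θr ≤ θ' ∧ θ' ≤ 1 ∧ 0 ≤ cH ∧ 0 < ω ∧ ρ₀ < 1 ∧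
        (δ + δ') * θr ^ k₀ +
            cH * (Real.exp 1 * 9 * 64 * K₀ 64 8 ^ 2 * A_A + Real.exp 1 * 9 * 64 * K₀ 64 8 ^ 2 * A_B) / (1 - ω) ≤ ρ₀ ∧
        0 ≤ B ∧ (∀ k < k₀, Real.exp 1 * 9 * 64 * K₀ 64 8 ^ 2 * A_A + Real.exp 1 * 9 * 64 * K₀ 64 8 ^ 2 * A_B ≤ B * θr ^ k) ∧
        Real.exp 1 * 9 * 64 * K₀ 64 8 ^ 2 * C3 * cH * ε₁ < (θ' - ω) * (1 - ρ₀) ∧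
        -- (ii) the towers' H-layer data in the configuration direction ON THE TABLES, both runs
        (∀ m, SpRestr (sp F θ k (m + 1))) ∧
        (∀ m, (S F θ k m).AnalyticH (box γ' m) (sp F θ k (m + 1))) ∧ (∀ m, (S F θ k m).Bound238 (box γ' m) (sp F θ k (m + 1)) A_A Rd) ∧ 0 ≤ A_A ∧
        A_A * Real.exp (5 * κ + 1) * K₀ 64 8 * 9 * 64 < 1 ∧
        (∀ m, SpRestr (sp F θ (k + 1) (m + 1))) ∧
        (∀ m, (S F θ (k + 1) m).AnalyticH (box γ' m) (sp F θ (k + 1) (m + 1))) ∧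
        (∀ m, (S F θ (k + 1) m).Bound238 (box γ' m) (sp F θ (k + 1) (m + 1)) A_B Rd) ∧
        0 ≤ A_B ∧ A_B * Real.exp (5 * κ + 1) * K₀ 64 8 * 9 * 64 < 1 ∧
        -- the reading's letters dominate the END's
        θ.γ ≤ γ' ∧ (li F θ).κ ≤ κ ∧ θ' ≤ (li F θ).θ₅ ∧
        (Real.exp 1 * 9 * 64 * K₀ 64 8 ^ 2 * (C3 * ε₁) / (1 - ρ₀) * (δ + δ') + B) * (θ' - ω) /
            (θ' - (ω + Real.exp 1 * 9 * 64 * K₀ 64 8 ^ 2 * (C3 * ε₁) / (1 - ρ₀) * cH)) ≤ (li F θ).C₅) :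
    S_N18 (RRec₁₃Co 𝔯) :=
  s_N18_rRec₁₃Co_of_forall_admissible_pin 𝔯 _ hpin fun F θ hP hA k =>
    n18At_u3OfRecord₁₃_readingAdm_of_envelope_bound238 θ k (S F θ) (sp F θ) (gauge F θ) (hg F θ) (T₀ F θ) (hT F θ) (li F θ) (h F θ hP hA k)

end Adm

end YMDAG.N18.W1Reading

end
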